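import Mathlib
import Summits.Ventures.PercRepro.TriangleCapZoneTools
import Summits.Ventures.PercRepro.TriangleCapZoneRows
import Summits.Ventures.PercRepro.TriangleCapZoneNarrowArith
import Summits.Ventures.PercRepro.TriangleCapStarFamilyThreshold

/-!
# PercRepro — THE UPPER REGIME `D < 2 r` ONE BELOW ITS THRESHOLD: THE ARITHMETIC (p3, gen 57; part 334)

With `ρ = D − r ≥ 2`, `X = D − 2 ρ ≥ 1` and `m = D + r − 3` (one below the threshold `m ≥ D + r − 2` of part 319)
the bottom of the deep sub-band is `min(2 r (D − r), 2 ρ (D − 2 ρ + 1) + E)` with `E = 2 (X − 1)` for `X ≥ 2` and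
`E = 4 ρ − 2` for `X = 1` (parts 335–337).  This part holds the pure arithmetic: THE ABSTRACT RESIDUE VALUE beyond
`I = ρ` — for `X ≥ 2` and `I ≥ ρ + 1` it is `≥ 2 ρ (X + 1) + 2 (X − 1)` (`residue_upper_one_below_wide`: the
window `ρ + 1 ≤ I ≤ r − 2` by `(k − 1)(X − k) ≥ 0`, beyond by `2 I + φ_D(2 r)`), for `X = 1` and `I ≥ ρ + 2` it is
`≥ 8 ρ − 2` (`residue_upper_one_below_tight`); THE COLUMN LOSS AT THE RESIDUE `1` with two partial members
(`column_loss_one`: `Σ c (D − c) ≥ 3 D − 5`); and THE ROW COST WITH `m + 2` ACTIVE ROWS (`rows_ge_of_active`: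
rows `≤ D` summing to `m D + Y`, `1 ≤ Y ≤ D − 1`, at least `m + 2` of them nonempty, cost
`≥ φ_D(Y) + 2 (Y − 1)`, and `≥ 3 (D − 1)` when `Y = 1` — `m` full rows leave two partial rows of sum `Y`, fewer full
rows leave `≥ q + 2` partial rows of sum `q D + Y` whose uniform bound `P (D − 1) + φ_{D−2}(S_p − P)` is evaluated at
`P = q + 2`, `q ≥ 1`).  Axioms: standard.
-/

namespace PercRepro

namespace TriangleCap

namespace C047

open Finset

/-- The residue of `D * q + a` is that of `a`. -/
theorem phiD_mul_add (D q a : ℕ) : phiD D (D * q + a) = phiD D a := by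
  rw [phiD_mod, Nat.mul_add_mod, ← phiD_mod]

/-- **THE ABSTRACT RESIDUE VALUE BEYOND `I = ρ`, WIDE REGIME `X = D − 2 ρ ≥ 2`:** for `D = 2 ρ + X`, `r = ρ + X`,
`t = m D + r`, `ρ + 1 ≤ I ≤ t`: `2 ρ (X + 1) + 2 (X − 1) ≤ 2 I + φ_D(t + I) + φ_D(t − I)`. -/
theorem residue_upper_one_below_wide (m ρ X I : ℕ) (hρ : 2 ≤ ρ) (hX : 2 ≤ X) (hI1 : ρ + 1 ≤ I)
    (hIt : I ≤ m * (2 * ρ + X) + (ρ + X)) :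
    2 * ρ * (X + 1) + 2 * (X - 1) ≤ 2 * I + phiD (2 * ρ + X) (m * (2 * ρ + X) + (ρ + X) + I) +
      phiD (2 * ρ + X) (m * (2 * ρ + X) + (ρ + X) - I) := by
  have hm1 : (2 * ρ + X) * (m + 1) = m * (2 * ρ + X) + (2 * ρ + X) := by ring
  have hm0 : (2 * ρ + X) * m = m * (2 * ρ + X) := by ring
  have hm2 : (2 * ρ + X) * (2 * m + 1) = 2 * (m * (2 * ρ + X)) + (2 * ρ + X) := by ring
  rcases Nat.lt_or_ge I (ρ + X - 1) with hlow | hhigh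
  · -- the window `ρ + 1 ≤ I ≤ r − 2`: `I = ρ + k`, `1 ≤ k ≤ X − 2`
    obtain ⟨k, rfl⟩ : ∃ k, I = ρ + k := ⟨I - ρ, by omega⟩
    have hk1 : 1 ≤ k := by omega
    have hkX : k + 2 ≤ X := by omega
    have e1 : m * (2 * ρ + X) + (ρ + X) + (ρ + k) = (2 * ρ + X) * (m + 1) + k := by omega
    have e2 : m * (2 * ρ + X) + (ρ + X) - (ρ + k) = (2 * ρ + X) * m + (X - k) := by omega
    rw [e1, e2, phiD_mul_add, phiD_mul_add, phiD_of_lt (2 * ρ + X) k (by omega),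
      phiD_of_lt (2 * ρ + X) (X - k) (by omega)]
    obtain ⟨k', rfl⟩ : ∃ k', k = k' + 1 := ⟨k - 1, by omega⟩
    obtain ⟨X', rfl⟩ : ∃ X', X = k' + 1 + X' + 2 := ⟨X - k' - 3, by omega⟩
    have f1 : k' + 1 + X' + 2 - (k' + 1) = X' + 2 := by omega
    have f2 : 2 * ρ + (k' + 1 + X' + 2) - (k' + 1) = 2 * ρ + X' + 2 := by omega
    have f3 : 2 * ρ + (k' + 1 + X' + 2) - (X' + 2) = 2 * ρ + k' + 1 := by omega
    have f4 : k' + 1 + X' + 2 - 1 = k' + X' + 2 := by omega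
    rw [f1, f2, f3, f4]
    nlinarith [Nat.zero_le (k' * X'), Nat.zero_le (ρ * X'), Nat.zero_le (ρ * k')]
  · -- beyond: `2 I ≥ 2 (r − 1)` and `φ_D(t + I) + φ_D(t − I) ≥ φ_D(2 t) = φ_D(2 r) = X · 2 ρ`
    have hsub := phiD_add_le (2 * ρ + X) (m * (2 * ρ + X) + (ρ + X) + I) (m * (2 * ρ + X) + (ρ + X) - I)
    have e : m * (2 * ρ + X) + (ρ + X) + I + (m * (2 * ρ + X) + (ρ + X) - I) =
        (2 * ρ + X) * (2 * m + 1) + X := by omega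
    rw [e, phiD_mul_add, phiD_of_lt (2 * ρ + X) X (by omega)] at hsub
    have f : 2 * ρ + X - X = 2 * ρ := by omega
    rw [f] at hsub
    obtain ⟨X', rfl⟩ : ∃ X', X = X' + 1 := ⟨X - 1, by omega⟩
    have g1 : 2 * (ρ + (X' + 1) - 1) ≤ 2 * I := by omega
    have g2 : 2 * ρ * (X' + 1 + 1) + 2 * (X' + 1 - 1) = 2 * (ρ + (X' + 1) - 1) + (X' + 1) * (2 * ρ) := by
      rw [show X' + 1 - 1 = X' by omega, show ρ + (X' + 1) - 1 = ρ + X' by omega]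
      ring
    omega

/-- **THE ABSTRACT RESIDUE VALUE BEYOND `I = ρ + 1`, TIGHT REGIME `D = 2 ρ + 1`:** for `r = ρ + 1`, `t = m D + r`,
`ρ + 2 ≤ I ≤ t`: `8 ρ − 2 ≤ 2 I + φ_D(t + I) + φ_D(t − I)`. -/
theorem residue_upper_one_below_tight (m ρ I : ℕ) (hρ : 2 ≤ ρ) (hI1 : ρ + 2 ≤ I)
    (hIt : I ≤ m * (2 * ρ + 1) + (ρ + 1)) :
    8 * ρ - 2 ≤ 2 * I + phiD (2 * ρ + 1) (m * (2 * ρ + 1) + (ρ + 1) + I) +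
      phiD (2 * ρ + 1) (m * (2 * ρ + 1) + (ρ + 1) - I) := by
  have hm1 : (2 * ρ + 1) * (m + 1) = m * (2 * ρ + 1) + (2 * ρ + 1) := by ring
  have hm2 : (2 * ρ + 1) * (2 * m + 1) = 2 * (m * (2 * ρ + 1)) + (2 * ρ + 1) := by ring
  rcases Nat.lt_or_ge I (3 * ρ - 1) with hlow | hhigh
  · -- `I = ρ + u`, `2 ≤ u ≤ 2 ρ − 2`
    obtain ⟨u, rfl⟩ : ∃ u, I = ρ + u := ⟨I - ρ, by omega⟩
    have hu2 : 2 ≤ u := by omega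
    have hu : u + 2 ≤ 2 * ρ := by omega
    have hm : 1 ≤ m := by
      by_contra h
      have : m = 0 := by omega
      subst this
      omega
    obtain ⟨m', rfl⟩ : ∃ m', m = m' + 1 := ⟨m - 1, by omega⟩
    have hm3 : (m' + 1) * (2 * ρ + 1) = (2 * ρ + 1) * m' + (2 * ρ + 1) := by ring
    have e1 : (m' + 1) * (2 * ρ + 1) + (ρ + 1) + (ρ + u) = (2 * ρ + 1) * (m' + 1 + 1) + u := by
      rw [show (2 * ρ + 1) * (m' + 1 + 1) = (2 * ρ + 1) * m' + (2 * ρ + 1) + (2 * ρ + 1) by ring]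
      omega
    have e2 : (m' + 1) * (2 * ρ + 1) + (ρ + 1) - (ρ + u) = (2 * ρ + 1) * m' + (2 * ρ + 1 + 1 - u) := by omega
    rw [e1, e2, phiD_mul_add, phiD_mul_add, phiD_of_lt (2 * ρ + 1) u (by omega),
      phiD_of_lt (2 * ρ + 1) (2 * ρ + 1 + 1 - u) (by omega)]
    obtain ⟨u', rfl⟩ : ∃ u', u = u' + 2 := ⟨u - 2, by omega⟩
    obtain ⟨w, hw⟩ : ∃ w, 2 * ρ = u' + 4 + w := ⟨2 * ρ - u' - 4, by omega⟩
    have f1 : 2 * ρ + 1 - (u' + 2) = w + 3 := by omega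
    have f2 : 2 * ρ + 1 + 1 - (u' + 2) = w + 4 := by omega
    have f3 : 2 * ρ + 1 - (w + 4) = u' + 1 := by omega
    rw [f1, f2, f3]
    have f4 : 8 * ρ - 2 = 4 * u' + 4 * w + 14 := by omega
    have f5 : 2 * (ρ + (u' + 2)) = 3 * u' + w + 8 := by omega
    rw [f4, f5]
    nlinarith [Nat.zero_le (u' * w)]
  · -- beyond: `2 I ≥ 6 ρ − 2` and `φ_D(t + I) + φ_D(t − I) ≥ φ_D(2 r) = φ_D(1) = 2 ρ`
    have hsub := phiD_add_le (2 * ρ + 1) (m * (2 * ρ + 1) + (ρ + 1) + I) (m * (2 * ρ + 1) + (ρ + 1) - I)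
    have e : m * (2 * ρ + 1) + (ρ + 1) + I + (m * (2 * ρ + 1) + (ρ + 1) - I) =
        (2 * ρ + 1) * (2 * m + 1) + 1 := by omega
    rw [e, phiD_mul_add, phiD_of_lt (2 * ρ + 1) 1 (by omega)] at hsub
    have f : 2 * ρ + 1 - 1 = 2 * ρ := by omega
    rw [f] at hsub
    omega

/-- **THE CORE OF THE COLUMN LOSS AT THE RESIDUE `1`:** two partial values `v, v'` and a rest `R` with
`v + v' + R ≡ 1 (mod D)`: `3 D − 5 ≤ v (D − v) + v' (D − v') + φ_D(R)`. -/
theorem column_loss_one_core (D v v' R : ℕ) (hD : 3 ≤ D) (hv : 1 ≤ v) (hvD : v + 1 ≤ D) (hv' : 1 ≤ v')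
    (hvD' : v' + 1 ≤ D) (hR : (v + v' + R) % D = 1) :
    3 * D - 5 ≤ v * (D - v) + v' * (D - v') + phiD D R := by
  have hD0 : 0 < D := by omega
  have hRm := Nat.mod_lt R hD0
  have hdiv := Nat.div_add_mod R D
  rcases Nat.lt_or_ge (v + v') (D + 1) with hlow | hhigh
  · -- `v + v' ≤ D`: the rest has residue `D + 1 − (v + v')`
    have hRres : R % D = D + 1 - (v + v') := by
      have h1 : (v + v' + R) % D = (v + v' + R % D) % D := by
        conv_lhs => rw [← hdiv]
        rw [show v + v' + (D * (R / D) + R % D) = D * (R / D) + (v + v' + R % D) by ring, Nat.mul_add_mod]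
      rw [h1] at hR
      rcases Nat.lt_or_ge (v + v' + R % D) D with hc | hc
      · rw [Nat.mod_eq_of_lt hc] at hR
        omega
      · have h2 : v + v' + R % D - D < D := by omega
        rw [Nat.mod_eq_sub_mod hc, Nat.mod_eq_of_lt h2] at hR
        omega
    rw [phiD_mod, hRres, phiD_of_lt D _ (by omega)]
    obtain ⟨a, rfl⟩ : ∃ a, v = a + 1 := ⟨v - 1, by omega⟩
    obtain ⟨b, rfl⟩ : ∃ b, v' = b + 1 := ⟨v' - 1, by omega⟩
    obtain ⟨c, rfl⟩ : ∃ c, D = a + b + 2 + c := ⟨D - a - b - 2, by omega⟩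
    have e1 : a + b + 2 + c - (a + 1) = b + 1 + c := by omega
    have e2 : a + b + 2 + c - (b + 1) = a + 1 + c := by omega
    have e3 : a + b + 2 + c + 1 - (a + 1 + (b + 1)) = c + 1 := by omega
    have e4 : a + b + 2 + c - (c + 1) = a + b + 1 := by omega
    have e5 : 3 * (a + b + 2 + c) - 5 = 3 * a + 3 * b + 3 * c + 1 := by omega
    rw [e1, e2, e3, e4, e5]
    nlinarith [Nat.zero_le (a * b), Nat.zero_le (a * c), Nat.zero_le (b * c)]
  · -- `v + v' = D + 1 + u`: the rest has residue `D − u` (or `0` at `u = 0`)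
    obtain ⟨u, hu⟩ : ∃ u, v + v' = D + 1 + u := ⟨v + v' - D - 1, by omega⟩
    have huD : u + 3 ≤ D := by omega
    have hRres : R % D = (D - u) % D := by
      have h1 : (v + v' + R) % D = (v + v' + R % D) % D := by
        conv_lhs => rw [← hdiv]
        rw [show v + v' + (D * (R / D) + R % D) = D * (R / D) + (v + v' + R % D) by ring, Nat.mul_add_mod]
      rw [h1, hu] at hR
      have h2 : (D + 1 + u + R % D) % D = (1 + u + R % D) % D := by
        rw [show D + 1 + u + R % D = D * 1 + (1 + u + R % D) by ring, Nat.mul_add_mod]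
      rw [h2] at hR
      rcases Nat.lt_or_ge (1 + u + R % D) D with hc | hc
      · rw [Nat.mod_eq_of_lt hc] at hR
        have : R % D = 0 := by omega
        rw [this]
        have : u = 0 := by omega
        subst this
        simp
      · have h3 : 1 + u + R % D - D < D := by omega
        rw [Nat.mod_eq_sub_mod hc, Nat.mod_eq_of_lt h3] at hR
        have : R % D = D - u := by omega
        rw [this, Nat.mod_eq_of_lt (by omega)]
    rw [phiD_mod, hRres]
    have hphi : phiD D ((D - u) % D) = u * (D - u) := by
      rcases Nat.eq_zero_or_pos u with rfl | hu0
      · rw [Nat.sub_zero, Nat.mod_self]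
        unfold phiD
        simp
      · rw [Nat.mod_eq_of_lt (by omega), phiD_of_lt D _ (by omega)]
        have : D - (D - u) = u := by omega
        rw [this]
        ring
    rw [hphi]
    obtain ⟨p, hp⟩ : ∃ p, v = D - 1 - p := ⟨D - 1 - v, by omega⟩
    obtain ⟨q, hq⟩ : ∃ q, v' = D - 1 - q := ⟨D - 1 - v', by omega⟩
    have hpq : p + q + u + 3 = D := by omega
    subst hp hq
    obtain ⟨D', hD'⟩ : ∃ D', D = p + q + u + 3 := ⟨0, by omega⟩
    subst hD'
    have e1 : p + q + u + 3 - 1 - p = q + u + 2 := by omega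
    have e2 : p + q + u + 3 - 1 - q = p + u + 2 := by omega
    have e3 : p + q + u + 3 - (q + u + 2) = p + 1 := by omega
    have e4 : p + q + u + 3 - (p + u + 2) = q + 1 := by omega
    have e5 : p + q + u + 3 - u = p + q + 3 := by omega
    have e6 : 3 * (p + q + u + 3) - 5 = 3 * p + 3 * q + 3 * u + 4 := by omega
    rw [e1, e2, e3, e4, e5, e6]
    nlinarith [Nat.zero_le (p * q), Nat.zero_le (p * u), Nat.zero_le (q * u)]

/-- **THE COLUMN LOSS AT THE RESIDUE `1`:** values `c ≤ D` on `s` with `Σ c ≡ 1 (mod D)` and two distinct partial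
members `1 ≤ c(x), c(x') ≤ D − 1`: `3 D − 5 ≤ Σ c (D − c)`. -/
theorem column_loss_one {ι : Type*} [DecidableEq ι] (s : Finset ι) (c : ι → ℕ) (D : ℕ) (hD : 3 ≤ D)
    (hc : ∀ i ∈ s, c i ≤ D) (x x' : ι) (hx : x ∈ s) (hx' : x' ∈ s) (hne : x ≠ x') (h1 : 1 ≤ c x)
    (h1D : c x + 1 ≤ D) (h1' : 1 ≤ c x') (h1D' : c x' + 1 ≤ D) (hsum : (∑ i ∈ s, c i) % D = 1) :
    3 * D - 5 ≤ ∑ i ∈ s, c i * (D - c i) := by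
  have hx'' : x' ∈ s.erase x := mem_erase.mpr ⟨hne.symm, hx'⟩
  rw [← sum_erase_add s _ hx, ← sum_erase_add (s.erase x) _ hx''] at hsum
  rw [← sum_erase_add s (fun i => c i * (D - c i)) hx, ← sum_erase_add (s.erase x) (fun i => c i * (D - c i)) hx'']
  have hrest := sum_mul_sub_ge_phi ((s.erase x).erase x') c D
    (fun i hi => hc i (mem_of_mem_erase (mem_of_mem_erase hi)))
  have hcore := column_loss_one_core D (c x) (c x') (∑ i ∈ (s.erase x).erase x', c i) hD h1 h1D h1' h1D'
    (by rw [← hsum]; congr 1; ring)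
  omega

/-- **THE ROW ARITHMETIC:** `(q + 2)(D − 1) + φ_{D−2}(q (D − 1) + Y − 2) ≥ φ_D(Y) + 2 (Y − 1)` for `1 ≤ q`,
`1 ≤ Y ≤ D − 1`, `3 ≤ D` (`q + Y < D`: the polynomial `q'^2 + 2 q' e + 5 q' + 2 e + 4`; else `(q + 2)(D − 1)`
alone). -/
theorem row_final (D Y q : ℕ) (hD : 3 ≤ D) (hY1 : 1 ≤ Y) (hYD : Y + 1 ≤ D) (hq : 1 ≤ q) :
    phiD D Y + 2 * (Y - 1) ≤ (q + 2) * (D - 1) + phiD (D - 2) (q * (D - 1) + Y - 2) := by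
  rw [phiD_of_lt D Y (by omega)]
  have e : q * (D - 1) + Y - 2 = (D - 2) * q + (q + Y - 2) := by
    obtain ⟨D', rfl⟩ : ∃ D', D = D' + 2 := ⟨D - 2, by omega⟩
    have : q * (D' + 2 - 1) = q * D' + q := by
      rw [show D' + 2 - 1 = D' + 1 by omega]
      ring
    rw [show D' + 2 - 2 = D' by omega, this]
    have : D' * q = q * D' := Nat.mul_comm _ _
    omega
  rw [e, phiD_mul_add]
  rcases Nat.lt_or_ge (q + Y - 2) (D - 2) with hlt | hge
  · rw [phiD_of_lt (D - 2) _ hlt]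
    obtain ⟨q', rfl⟩ : ∃ q', q = q' + 1 := ⟨q - 1, by omega⟩
    obtain ⟨Y', rfl⟩ : ∃ Y', Y = Y' + 1 := ⟨Y - 1, by omega⟩
    obtain ⟨e', he⟩ : ∃ e', D = q' + Y' + 3 + e' := ⟨D - q' - Y' - 3, by omega⟩
    subst he
    have f1 : q' + Y' + 3 + e' - (Y' + 1) = q' + e' + 2 := by omega
    have f2 : Y' + 1 - 1 = Y' := by omega
    have f3 : q' + Y' + 3 + e' - 1 = q' + Y' + e' + 2 := by omega
    have f4 : q' + 1 + (Y' + 1) - 2 = q' + Y' := by omega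
    have f5 : q' + Y' + 3 + e' - 2 - (q' + Y') = e' + 1 := by omega
    rw [f1, f2, f3, f4, f5]
    nlinarith [Nat.zero_le (q' * e'), Nat.zero_le (q' * Y'), Nat.zero_le (Y' * e'), Nat.zero_le (q' * q')]
  · -- `q ≥ D − Y`: `(q + 2)(D − 1) ≥ (D − Y + 2)(D − 1) ≥ Y (D − Y) + 2 (Y − 1)`
    have hq' : D - Y ≤ q := by omega
    have h1 : (D - Y + 2) * (D - 1) ≤ (q + 2) * (D - 1) := Nat.mul_le_mul_right _ (by omega)
    have h2 : Y * (D - Y) + 2 * (Y - 1) ≤ (D - Y + 2) * (D - 1) := by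
      obtain ⟨Y', rfl⟩ : ∃ Y', Y = Y' + 1 := ⟨Y - 1, by omega⟩
      obtain ⟨u, hu⟩ : ∃ u, D = Y' + 1 + u := ⟨D - Y' - 1, by omega⟩
      subst hu
      have f1 : Y' + 1 + u - (Y' + 1) = u := by omega
      have f2 : Y' + 1 - 1 = Y' := by omega
      have f3 : Y' + 1 + u - 1 = Y' + u := by omega
      rw [f1, f2, f3]
      nlinarith [Nat.zero_le (Y' * u), Nat.zero_le (u * u)]
    omega

/-- **THE ROW COST WITH `m + 2` ACTIVE ROWS:** rows `c ≤ D` on `s` with `Σ c = m D + Y`, `1 ≤ Y ≤ D − 1`, at least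
`m + 2` of them nonempty: `φ_D(Y) + 2 (Y − 1) ≤ Σ c (D − c)`, and `3 (D − 1) ≤ Σ c (D − c)` when `Y = 1` (then
at most `m − 1` rows are full and at least three are partial). -/
theorem rows_ge_of_active {ι : Type*} [DecidableEq ι] (s : Finset ι) (c : ι → ℕ) (D m Y : ℕ) (hD : 3 ≤ D)
    (hc : ∀ i ∈ s, c i ≤ D) (hY1 : 1 ≤ Y) (hYD : Y + 1 ≤ D) (hsum : ∑ i ∈ s, c i = m * D + Y)
    (hact : m + 2 ≤ (s.filter (fun i => 1 ≤ c i)).card) :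
    phiD D Y + 2 * (Y - 1) ≤ ∑ i ∈ s, c i * (D - c i) ∧
      (Y = 1 → 3 * (D - 1) ≤ ∑ i ∈ s, c i * (D - c i)) := by
  set Fs := s.filter (fun i => c i = D) with hFs
  set Ps := s.filter (fun i => 1 ≤ c i ∧ c i + 1 ≤ D) with hPs
  -- the active rows are the full ones and the partial ones
  have hsplit : s.filter (fun i => 1 ≤ c i) = Fs ∪ Ps := by
    ext i
    simp only [hFs, hPs, mem_filter, mem_union]
    constructor
    · rintro ⟨hi, h1⟩
      have := hc i hi
      by_cases h : c i = D
      · exact Or.inl ⟨hi, h⟩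
      · exact Or.inr ⟨hi, h1, by omega⟩
    · rintro (⟨hi, h⟩ | ⟨hi, h1, _⟩)
      · exact ⟨hi, by omega⟩
      · exact ⟨hi, h1⟩
  have hdisj : Disjoint Fs Ps := by
    rw [disjoint_left]
    intro i hi hi'
    simp only [hFs, hPs, mem_filter] at hi hi'
    omega
  rw [hsplit, card_union_of_disjoint hdisj] at hact
  -- the sums: `Σ_s c = D |Fs| + Σ_Ps c`, `Σ_s c (D − c) ≥ Σ_Ps c (D − c)`
  have hsumF : ∑ i ∈ Fs, c i = D * Fs.card := by
    rw [sum_const_nat (m := D) (fun i hi => (mem_filter.mp hi).2), Nat.mul_comm]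
  have hsum_split : ∑ i ∈ s, c i = ∑ i ∈ Fs, c i + ∑ i ∈ Ps, c i := by
    have h1 := sum_filter_add_sum_filter_not s (fun i => c i = D) c
    have h2 := sum_filter_add_sum_filter_not (s.filter (fun i => ¬ c i = D)) (fun i => 1 ≤ c i ∧ c i + 1 ≤ D) c
    rw [filter_filter] at h2
    have h3 : ∑ i ∈ (s.filter (fun i => ¬ c i = D)).filter (fun i => ¬ (1 ≤ c i ∧ c i + 1 ≤ D)), c i = 0 := by
      apply sum_eq_zero
      intro i hi
      rw [mem_filter, mem_filter] at hi
      have := hc i hi.1.1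
      omega
    have h4 : (s.filter (fun i => ¬ c i = D ∧ (1 ≤ c i ∧ c i + 1 ≤ D))) = Ps := by
      rw [hPs]
      apply filter_congr
      intro i _
      constructor
      · rintro ⟨_, h⟩
        exact h
      · rintro h
        exact ⟨by omega, h⟩
    rw [h4, h3, add_zero] at h2
    rw [← h1, ← h2]
  have hsubP : Ps ⊆ s := filter_subset _ _
  have hcostP : ∑ i ∈ Ps, c i * (D - c i) ≤ ∑ i ∈ s, c i * (D - c i) :=
    sum_le_sum_of_subset (f := fun i => c i * (D - c i)) hsubP
  have hPle : Ps.card ≤ ∑ i ∈ Ps, c i := by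
    rw [card_eq_sum_ones]
    apply sum_le_sum
    intro i hi
    exact (mem_filter.mp hi).2.1
  have hP1 : ∀ i ∈ Ps, 1 ≤ c i := fun i hi => (mem_filter.mp hi).2.1
  have hPD : ∀ i ∈ Ps, c i + 1 ≤ D := fun i hi => (mem_filter.mp hi).2.2
  rw [hsum_split, hsumF] at hsum
  -- `|Fs| ≤ m`
  have hFm : Fs.card ≤ m := by
    by_contra h
    rw [not_le] at h
    have : D * (m + 1) ≤ D * Fs.card := Nat.mul_le_mul_left _ h
    have : D * (m + 1) = D * m + D := by ring
    have : m * D = D * m := Nat.mul_comm _ _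
    omega
  rcases Nat.lt_or_ge Fs.card m with hlt | hge
  · -- fewer than `m` full rows: `q = m − |Fs| ≥ 2`, `Σ_Ps c = q D + Y`, `|Ps| ≥ q + 2`
    obtain ⟨q, hq⟩ : ∃ q, m = Fs.card + q := ⟨m - Fs.card, by omega⟩
    have hq1 : 1 ≤ q := by omega
    have hSp : ∑ i ∈ Ps, c i = q * D + Y := by
      have : m * D = Fs.card * D + q * D := by rw [hq]; ring
      have : D * Fs.card = Fs.card * D := Nat.mul_comm _ _
      omega
    have hPq : q + 2 ≤ Ps.card := by omega
    have huni := sum_partial_ge_card_add_phi Ps c D hP1 hPD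
    have hmono := uniform_row_mono D (∑ i ∈ Ps, c i) (q + 2) Ps.card hD hPq hPle
    rw [hSp] at hmono huni
    have hfin := row_final D Y q hD hY1 hYD hq1
    have e : q * D + Y - (q + 2) = q * (D - 1) + Y - 2 := by
      have : q * D = q * (D - 1) + q := by
        obtain ⟨D', rfl⟩ : ∃ D', D = D' + 1 := ⟨D - 1, by omega⟩
        rw [Nat.add_sub_cancel]
        ring
      omega
    rw [e] at hmono
    refine ⟨by omega, fun _ => ?_⟩
    have : 3 * (D - 1) ≤ Ps.card * (D - 1) := Nat.mul_le_mul_right _ (by omega)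
    omega
  · -- exactly `m` full rows: `Σ_Ps c = Y`, `|Ps| ≥ 2`
    have hF : Fs.card = m := le_antisymm hFm hge
    have hSp : ∑ i ∈ Ps, c i = Y := by
      rw [hF] at hsum
      have : m * D = D * m := Nat.mul_comm _ _
      omega
    have hP2 : 2 ≤ Ps.card := by omega
    have hpair := sum_partial_ge_phi_add Ps c D hP1 hPD (by rw [hSp]; omega) hP2
    rw [hSp] at hpair
    refine ⟨by omega, fun hY => ?_⟩
    exfalso
    rw [hSp, hY] at hPle
    omega

end C047

end TriangleCap

end PercRepro
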